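import Literature.AlgebraicGeometry.HodgeTheory.WeilClassesFieldCMFieldEndLevel
import Literature.AlgebraicGeometry.HodgeTheory.WeilClassesFieldQuaternionOverRealFieldDecomposable
import Literature.AlgebraicGeometry.HodgeTheory.WeilClassesFieldQuaternionOverRealFieldMatricesDecomposable
import Literature.AlgebraicGeometry.HodgeTheory.WeilClassesFieldRealMultiplicationMatricesDecomposable
import HarnessLib

/-!
# Moonen–Zarhin's Criterion (2), TYPES 1 AND 2 FROM `End(A)`-LEVEL DATA: if `End⁰(A) = E = ℚ(ψ)` is a real-multiplication
# field (`ψ† = ψ`), or `End⁰(A) = D = ℚ(ψ)⟨α, β⟩` is a quaternion algebra over `E` presented by a Rosati-SYMMETRIC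
# anticommuting pair, then for EVERY `φ ∈ End(A)` and EVERY `φ ∈ End(A^{n+1})` the Weil classes of `F = ℚ(φ)` are
# decomposable, hence algebraic («if `X` is of type 1 or 2 … `G_div(X)` acts trivially on `W_F`»; Moonen–Zarhin 1998
# §1, Criterion (2))

Layer `Literature/AlgebraicGeometry/HodgeTheory`; THEOREMS ONLY — no definition, no named fact, no `sorry` (D-0026, net
debt 0).  End-level wrappers, in the format of `WeilClassesFieldDefiniteQuaternionMatricesEndLevel` (type 3) and
`WeilClassesFieldCMFieldEndLevel` (type 4, `d = 1`), of the seat's carrier theorems for types 1 and 2: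
`WeilClassesFieldPolynomialOfSymmetricDecomposable` / `WeilClassesFieldRealMultiplicationMatricesDecomposable` (type 1,
`m = 1` / powers) and `WeilClassesFieldQuaternionOverRealFieldDecomposable` / `…MatricesDecomposable` (type 2, `m = 1` /
powers), whose hypothesis «`F ⊆ E`» / «`F ⊆ D`» / «`F ⊆ M_{n+1}(·)`» — `φ^*` in the complex algebra generated by the
(diagonal) generators (and the matrix units) — is DISCHARGED, for every `φ`, from «`End⁰(A) = E`» resp. «`End⁰(A) = D`»:
every `g ∈ End(A)` has a non-zero integer multiple in `ℤ[ψ]` resp. `ℤ⟨ψ, α, β⟩` (`hD`).  With the type-3 files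
(`…DefiniteQuaternionMatricesEndLevel`, `…DefiniteQuaternionDichotomy`, `…DefiniteQuaternionCentral`) and the type-4,
`d = 1` file (`…CMFieldEndLevel`) this puts every row of Criterion (2) with `d ≤ 2`, except type 4 with `d = 2`, in
`End(A)`-level form.

## The print

B. J. J. Moonen, Yu. G. Zarhin, *Weil classes on abelian varieties*, J. reine angew. Math. **496** (1998) 83–92 =
arXiv:alg-geom/9612017 [MoonenZarhin1998WeilClasses] (held text `paper:arxiv-alg-geom_9612017`), §1 Criterion (2)
(chunk p0003 L59–L80): the exceptional alternative «occurs precisely in the following cases: `Y` is of Type 3 …, `Y` is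
of Type 4 …» — so NOT for types 1 and 2; its proof (chunk p0003 L82–L90), VERBATIM: «First assume that `X` is either
of type 1, 2 or of type 3 with `m = 1`, or that `X` is of type 4 with `d = 1` and `m = 1`.  We claim that, in these
cases, `G_div(X)` acts as the identity on `W_F` if and only if `F ⊆ B`. … Conversely, suppose that `F ⊆ B`, so that
`G_div(X) ⊆ Gl_F(V_X)`.  In the cases we are considering, the group `G_div(X)` is connected and semi-simple, so
`G_div(X) ⊆ Sl_F(V_X)`, hence `G_div(X)` acts trivially on `W_F`.» with «(In fact, if `m ≥ 2` or if `X` is of type 1 or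
2, then we simply have `Δ = D`.  If `m = 1` then `Δ = B`.)» (chunk p0002 L96–L97: `B = End⁰(X)` for types 1, 2), and
Remark (1) (chunk p0004 L57–L59): «if `X` is of type 1, 2 or 3, then the spaces `W_F` and `W_{F′}` always consist of
Hodge classes».
H. Lange, Ch. Birkenhake [LangeBirkenhake1992], §1.1 (rational representation), §5.5 (types I and II: `End⁰` a totally
real field, resp. a totally indefinite quaternion algebra, with positive Rosati involution).

## The data in `End(A)`

TYPE 1: `ψ ∈ End(A)` Rosati-symmetric (`Q_h(ψ^* v, w) = Q_h(v, ψ^* w)`) with `Q(ψ) = 0` (`Q ∈ ℤ[T]` monic irreducible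
over `ℚ`, needed for the powers only), and `hD : ∀ g, ∃ N ≠ 0, N g ∈ ℤ[ψ]` («`End⁰(A) = E = ℚ(ψ)`»).
TYPE 2: in addition `α, β ∈ End(A)` Rosati-SYMMETRIC with `ψα = αψ`, `ψβ = βψ`, `αβ = -βα`, `α² = a(ψ)`, `β² = b(ψ)`
(`a, b ∈ ℤ[X]` non-vanishing at the complex roots of `Q`), and `hD : ∀ g, ∃ N ≠ 0, N g ∈ ℤ⟨ψ, α, β⟩`
(«`End⁰(A) = D = ℚ(ψ)⟨α, β⟩`»).  In both: `h ∈ B¹(A) ⊗ ℂ` with `Q_h` non-degenerate (and `h^{dim A} ≠ 0` for the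
powers, which carry the product polarization); `φ` with `P(φ) = 0`, `P` monic irreducible of degree `e`, `e · 2m = 2 dim`.

## What is proved

* §1 `pullbackOne_mem_adjoin_triple_of_forall_exists_zsmul_mem_closure_triple` («`End⁰(A) = ℚ⟨ψ, α, β⟩`» ⟹ every
  `g^* ∈ ℂ⟨ψ^*, α^*, β^*⟩`).
* §2 TYPE 1: **`weilClassesField_le_divisorClassesSpan_of_realMultiplicationField_End`** /
  `weilClassesField_le_algebraicClasses_of_realMultiplicationField_End` (on `A`, every `φ ∈ End(A)`);
  **`weilClassesField_biproduct_le_divisorClassesSpan_of_realMultiplicationField_End`** /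
  `weilClassesField_biproduct_le_algebraicClasses_of_realMultiplicationField_End` (on `A^{n+1}`, every `φ ∈ End(A^{n+1})`).
* §3 TYPE 2: **`weilClassesField_le_divisorClassesSpan_of_indefiniteQuaternionOver_End`** /
  `weilClassesField_le_algebraicClasses_of_indefiniteQuaternionOver_End` (on `A`);
  **`weilClassesField_biproduct_le_divisorClassesSpan_of_indefiniteQuaternionOver_End`** /
  `weilClassesField_biproduct_le_algebraicClasses_of_indefiniteQuaternionOver_End` (on `A^{n+1}`).

## Scope (honest column)

As in the other End-level files: the type is the PRESENTATION (`hD` + Rosati signs of the generators), not Albert's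
classification; the positivity of the Rosati involution and the definiteness/indefiniteness of `D` are not used beyond
the stated signs (`α, β` symmetric here, skew in the type-3 files); `h` is any class with the stated non-degeneracy.
Everything is on `ℂ`-points of Milne's `S(A)(h)`.

## References

* [MoonenZarhin1998WeilClasses] B. J. J. Moonen, Yu. G. Zarhin, Weil classes on abelian varieties, J. reine angew.
  Math. 496 (1998) 83–92; arXiv:alg-geom/9612017: §1 (chunk p0002 L43–L118), Criterion (2) and its proof (chunk p0003
  L59–L90), Remark (1) (chunk p0004 L53–L75).
* [Milne1999LefschetzClasses] J. S. Milne, Lefschetz classes on abelian varieties, Duke Math. J. 96 (1999), §1 p. 643,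
  Thm. 3.2, Cor. 4.5.
* [LangeBirkenhake1992] H. Lange, Ch. Birkenhake, Complex Abelian Varieties, Grundlehren 302 (1992), §1.1, §5.5.
* [VoisinHodgeI2002] C. Voisin, Hodge Theory and Complex Algebraic Geometry I (CUP 2002), Thm. 11.30 (Lefschetz (1,1)).

## Provenance

Lane `lit-hodgefound` (Track 2, Layer A), prover seat `lit-hodgefound-p21` (generation 24), row g24-#4.
-/

noncomputable section

open CategoryTheory CategoryTheory.Limits
open Polynomial Module

namespace Literature.AlgebraicGeometry.HodgeTheory

open Literature.AlgebraicTopology.SingularHomology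
open Literature.AlgebraicGeometry.Motives
open Literature.AlgebraicGeometry.VanGeemen1994 (hodgeClassSpan pullbackOne)
open Literature.AlgebraicGeometry.Milne1999
open Literature.Geometry.Kaehler (lefschetzPow)
open Literature.Barriers.HodgeConjecture (divisorClassesSpan)

/-! ### §1 «`End⁰(A) = ℚ⟨ψ, α, β⟩`» on `H¹(A)` -/

section Generators

variable {A : AbelianVariety ℂ} {ψ α β : A ⟶ A}

/-- **«`End⁰(A) = ℚ⟨ψ, α, β⟩`» ⟹ every `g^*` lies in `ℂ⟨ψ^*, α^*, β^*⟩`** (`N g ∈ ℤ⟨ψ, α, β⟩`, divide by `N` over `ℂ`).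
[cite: MoonenZarhin1998WeilClasses, §1 («D = End⁰(Y)», «F ↪ End⁰(X)»; chunk p0002 L46–L60)] [cite: LangeBirkenhake1992, §1.1] -/
theorem pullbackOne_mem_adjoin_triple_of_forall_exists_zsmul_mem_closure_triple
    (hD : ∀ g : A ⟶ A, ∃ N : ℤ, N ≠ 0 ∧ End.of (N • g) ∈ Subring.closure {End.of ψ, End.of α, End.of β})
    (g : A ⟶ A) :
    pullbackOne A g ∈ Algebra.adjoin ℂ
      ({pullbackOne A ψ, pullbackOne A α, pullbackOne A β} : Set (Module.End ℂ (complexBetti A.X 1))) := by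
  obtain ⟨N, hN0, hN⟩ := hD g
  have h1 : pullbackOne A (N • g) ∈ Algebra.adjoin ℂ
      ({pullbackOne A ψ, pullbackOne A α, pullbackOne A β} : Set (Module.End ℂ (complexBetti A.X 1))) :=
    pullbackOne_mem_adjoin_triple_of_mem_closure hN
  rw [pullbackOne_zsmul] at h1
  have e : pullbackOne A g = ((N : ℂ)⁻¹) • ((N : ℂ) • pullbackOne A g) := by
    rw [smul_smul, inv_mul_cancel₀ (Int.cast_ne_zero.2 hN0), one_smul]
  rw [e]
  exact Subalgebra.smul_mem _ h1 _

end Generators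

/-! ### §2 TYPE 1: `End⁰(A) = E = ℚ(ψ)` a real-multiplication field — every `W_F` decomposable -/

section TypeOne

variable {A : AbelianVariety ℂ} {h : complexBetti A.X 2} {ψ φ : A ⟶ A} {P Q : Polynomial ℤ} {e m : ℕ} {n : ℕ}
  {Φ : ⨁ (fun _ : Fin (n + 1) => A) ⟶ ⨁ (fun _ : Fin (n + 1) => A)}

/-- **TYPE 1 FROM `End(A)`, `m = 1`: EVERY `φ ∈ End(A)` HAS DECOMPOSABLE WEIL CLASSES** when `End⁰(A) = ℚ(ψ)` with `ψ`
Rosati-symmetric (every `g ∈ End(A)` has a non-zero multiple in `ℤ[ψ]`): `φ^* ∈ ℂ[ψ^*]` is `Q_h`-symmetric.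
[cite: MoonenZarhin1998WeilClasses, §1 Criterion (2) and its proof, type 1 («G_div(X) acts trivially on W_F»; chunk p0003 L59–L90)]
[cite: Milne1999LefschetzClasses, Thm. 3.2, Cor. 4.5] [cite: LangeBirkenhake1992, §5.5] -/
theorem weilClassesField_le_divisorClassesSpan_of_realMultiplicationField_End (hA : 0 < A.dim) (hPm : P.Monic)
    (hPe : P.natDegree = e) (hPirr : Irreducible (P.map (Int.castRingHom ℚ)))
    (hφ : Polynomial.eval₂ (Int.castRingHom (CategoryTheory.End A)) (φ : CategoryTheory.End A) P = 0)
    (her : e * (2 * m) = 2 * A.dim) (hh : h ∈ hodgeClassSpan A.dim A.X 1)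
    (hnd : ∀ x : complexBetti A.X 1, (∀ y, polarizationPairingOne A.X h (A.dim - 1) x y = 0) → x = 0)
    (hψsym : ∀ v w : complexBetti A.X 1, polarizationPairingOne A.X h (A.dim - 1) (pullbackOne A ψ v) w =
      polarizationPairingOne A.X h (A.dim - 1) v (pullbackOne A ψ w))
    (hD : ∀ g : A ⟶ A, ∃ N : ℤ, N ≠ 0 ∧ End.of (N • g) ∈ Subring.closure {End.of ψ}) :
    weilClassesField A φ P (2 * m) ≤ divisorClassesSpan A.X A.dim m :=
  weilClassesField_le_divisorClassesSpan_of_mem_adjoin_singleton_of_symm hA hPm hPe hPirr hφ her hh hnd hψsym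
    (pullbackOne_mem_adjoin_singleton_of_forall_exists_zsmul_mem_closure_singleton hD φ)

/-- **… hence ALGEBRAIC** (Lefschetz `(1,1)`). [cite: MoonenZarhin1998WeilClasses, Introduction (chunk p0001 L10–L18) and §1 Criterion (2) (chunk p0003 L59–L90)]
[cite: VoisinHodgeI2002, Thm. 11.30] -/
theorem weilClassesField_le_algebraicClasses_of_realMultiplicationField_End (hA : 0 < A.dim) (hPm : P.Monic)
    (hPe : P.natDegree = e) (hPirr : Irreducible (P.map (Int.castRingHom ℚ)))
    (hφ : Polynomial.eval₂ (Int.castRingHom (CategoryTheory.End A)) (φ : CategoryTheory.End A) P = 0)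
    (her : e * (2 * m) = 2 * A.dim) (hh : h ∈ hodgeClassSpan A.dim A.X 1)
    (hnd : ∀ x : complexBetti A.X 1, (∀ y, polarizationPairingOne A.X h (A.dim - 1) x y = 0) → x = 0)
    (hψsym : ∀ v w : complexBetti A.X 1, polarizationPairingOne A.X h (A.dim - 1) (pullbackOne A ψ v) w =
      polarizationPairingOne A.X h (A.dim - 1) v (pullbackOne A ψ w))
    (hD : ∀ g : A ⟶ A, ∃ N : ℤ, N ≠ 0 ∧ End.of (N • g) ∈ Subring.closure {End.of ψ}) :
    weilClassesField A φ P (2 * m) ≤ algebraicClasses A.X m :=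
  (weilClassesField_le_divisorClassesSpan_of_realMultiplicationField_End hA hPm hPe hPirr hφ her hh hnd hψsym hD).trans
    (AbelianVariety.divisorClassesSpan_le_algebraicClasses A
      (fun c hc hc' ↦ lefschetzOneOne_rational_holds (AbelianVariety.isSmoothProjective_holds (A := A)) c hc hc') m)

/-- **TYPE 1 FROM `End(A)`, POWERS: EVERY `φ ∈ End(A^{n+1})` HAS DECOMPOSABLE WEIL CLASSES** when `End⁰(A) = ℚ(ψ)`
with `ψ` Rosati-symmetric and `Q(ψ) = 0` (`Q` monic irreducible over `ℚ`); `X = A^{n+1}` with the product polarization,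
`h^{dim A} ≠ 0`: «`F ⊆ End⁰(X) = M_{n+1}(E)`» is automatic (§1 of `WeilClassesFieldCMFieldEndLevel`), and the seat's
`weilClassesField_biproduct_le_divisorClassesSpan_of_mem_adjoin_diagonal` applies.
[cite: MoonenZarhin1998WeilClasses, §1 Criterion (2) and its proof, type 1 with m ≥ 2 («Δ = D», «G_div(X) ⊆ Sl_F(V_X)»; chunk p0002 L96–L97, p0003 L59–L90)]
[cite: Milne1999LefschetzClasses, §1 p. 643, Thm. 3.2, Cor. 4.5] -/
theorem weilClassesField_biproduct_le_divisorClassesSpan_of_realMultiplicationField_End (hA : 0 < A.dim)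
    (hh : h ∈ hodgeClassSpan A.dim A.X 1) (htop : lefschetzPow h (A.dim - 1) 2 h ≠ 0)
    (hnd : ∀ x : complexBetti A.X 1, (∀ y, polarizationPairingOne A.X h (A.dim - 1) x y = 0) → x = 0)
    (hψsym : ∀ v w : complexBetti A.X 1, polarizationPairingOne A.X h (A.dim - 1) (pullbackOne A ψ v) w =
      polarizationPairingOne A.X h (A.dim - 1) v (pullbackOne A ψ w))
    (hQm : Q.Monic) (hQirr : Irreducible (Q.map (Int.castRingHom ℚ)))
    (hψQ : Polynomial.eval₂ (Int.castRingHom (CategoryTheory.End A)) (ψ : CategoryTheory.End A) Q = 0)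
    (hD : ∀ g : A ⟶ A, ∃ N : ℤ, N ≠ 0 ∧ End.of (N • g) ∈ Subring.closure {End.of ψ})
    (hPm : P.Monic) (hPe : P.natDegree = e) (hPirr : Irreducible (P.map (Int.castRingHom ℚ)))
    (hΦ : Polynomial.eval₂ (Int.castRingHom (CategoryTheory.End (⨁ (fun _ : Fin (n + 1) => A))))
      (Φ : CategoryTheory.End (⨁ (fun _ : Fin (n + 1) => A))) P = 0)
    (her : e * (2 * m) = 2 * ((n + 1) * A.dim)) :
    weilClassesField (⨁ (fun _ : Fin (n + 1) => A)) Φ P (2 * m) ≤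
      divisorClassesSpan (⨁ (fun _ : Fin (n + 1) => A)).X (⨁ (fun _ : Fin (n + 1) => A)).dim m :=
  weilClassesField_biproduct_le_divisorClassesSpan_of_mem_adjoin_diagonal hA hh htop hnd hψsym hQm hQirr hψQ hPm hPe hPirr
    hΦ her (pullbackOne_biproduct_mem_adjoin_diagonal_of_forall_exists_zsmul_mem_closure_singleton hD Φ)

/-- **… hence ALGEBRAIC** on `A^{n+1}`. [cite: MoonenZarhin1998WeilClasses, Introduction (chunk p0001 L10–L18) and §1 Criterion (2) (chunk p0003 L59–L90)]
[cite: VoisinHodgeI2002, Thm. 11.30] -/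
theorem weilClassesField_biproduct_le_algebraicClasses_of_realMultiplicationField_End (hA : 0 < A.dim)
    (hh : h ∈ hodgeClassSpan A.dim A.X 1) (htop : lefschetzPow h (A.dim - 1) 2 h ≠ 0)
    (hnd : ∀ x : complexBetti A.X 1, (∀ y, polarizationPairingOne A.X h (A.dim - 1) x y = 0) → x = 0)
    (hψsym : ∀ v w : complexBetti A.X 1, polarizationPairingOne A.X h (A.dim - 1) (pullbackOne A ψ v) w =
      polarizationPairingOne A.X h (A.dim - 1) v (pullbackOne A ψ w))
    (hQm : Q.Monic) (hQirr : Irreducible (Q.map (Int.castRingHom ℚ)))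
    (hψQ : Polynomial.eval₂ (Int.castRingHom (CategoryTheory.End A)) (ψ : CategoryTheory.End A) Q = 0)
    (hD : ∀ g : A ⟶ A, ∃ N : ℤ, N ≠ 0 ∧ End.of (N • g) ∈ Subring.closure {End.of ψ})
    (hPm : P.Monic) (hPe : P.natDegree = e) (hPirr : Irreducible (P.map (Int.castRingHom ℚ)))
    (hΦ : Polynomial.eval₂ (Int.castRingHom (CategoryTheory.End (⨁ (fun _ : Fin (n + 1) => A))))
      (Φ : CategoryTheory.End (⨁ (fun _ : Fin (n + 1) => A))) P = 0)
    (her : e * (2 * m) = 2 * ((n + 1) * A.dim)) :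
    weilClassesField (⨁ (fun _ : Fin (n + 1) => A)) Φ P (2 * m) ≤ algebraicClasses (⨁ (fun _ : Fin (n + 1) => A)).X m :=
  weilClassesField_biproduct_le_algebraicClasses_of_mem_adjoin_diagonal hA hh htop hnd hψsym hQm hQirr hψQ hPm hPe hPirr
    hΦ her (pullbackOne_biproduct_mem_adjoin_diagonal_of_forall_exists_zsmul_mem_closure_singleton hD Φ)

end TypeOne

/-! ### §3 TYPE 2: `End⁰(A) = D = ℚ(ψ)⟨α, β⟩`, `α, β` Rosati-symmetric — every `W_F` decomposable -/

section TypeTwo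

variable {A : AbelianVariety ℂ} {h : complexBetti A.X 2} {ψ α β φ : A ⟶ A} {P Q qa qb : Polynomial ℤ} {e m : ℕ} {n : ℕ}
  {Φ : ⨁ (fun _ : Fin (n + 1) => A) ⟶ ⨁ (fun _ : Fin (n + 1) => A)}

/-- **TYPE 2 FROM `End(A)`, `m = 1`: EVERY `φ ∈ End(A)` HAS DECOMPOSABLE WEIL CLASSES.**  Let `ψ ∈ End(A)` be
Rosati-symmetric with `Q(ψ) = 0` (`Q` monic irreducible over `ℚ`), `α, β ∈ End(A)` Rosati-SYMMETRIC with `ψα = αψ`,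
`ψβ = βψ`, `αβ = -βα`, `α² = a(ψ)`, `β² = b(ψ)` (`a, b ∈ ℤ[X]` non-vanishing at the complex roots of `Q`), and let every
`g ∈ End(A)` have a non-zero integer multiple in `ℤ⟨ψ, α, β⟩` («`End⁰(A) = D`», a quaternion algebra over `E = ℚ(ψ)`
so presented); `h ∈ B¹ ⊗ ℂ` with `Q_h` non-degenerate.  Then for every `φ ∈ End(A)` with `P(φ) = 0`
(`e · 2m = 2 dim A`): `W_F ⊗ ℂ ≤ 𝒟ᵐ ⊗ ℂ` — the seat's `weilClassesField_le_divisorClassesSpan_of_mem_adjoin_quaternionOver`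
with `φ^* ∈ ℂ⟨ψ^*, α^*, β^*⟩` from §1 and the algebra transported from `End(A)`.
[cite: MoonenZarhin1998WeilClasses, §1 Criterion (2) and its proof, type 2 («Δ = D», «G_div(X) ⊆ Sl_F(V_X)»; chunk p0002 L96–L97, p0003 L59–L90); Tables 1–2 (chunk p0002 L104–L118)]
[cite: Milne1999LefschetzClasses, Thm. 3.2, Cor. 4.5] [cite: LangeBirkenhake1992, §1.1, §5.5] -/
theorem weilClassesField_le_divisorClassesSpan_of_indefiniteQuaternionOver_End (hPm : P.Monic) (hPe : P.natDegree = e)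
    (hPirr : Irreducible (P.map (Int.castRingHom ℚ)))
    (hφ : Polynomial.eval₂ (Int.castRingHom (CategoryTheory.End A)) (φ : CategoryTheory.End A) P = 0)
    (her : e * (2 * m) = 2 * A.dim) (hh : h ∈ hodgeClassSpan A.dim A.X 1)
    (hnd : ∀ v : complexBetti A.X 1, (∀ w, polarizationPairingOne A.X h (A.dim - 1) v w = 0) → v = 0)
    (hψsym : ∀ v w : complexBetti A.X 1, polarizationPairingOne A.X h (A.dim - 1) (pullbackOne A ψ v) w =
      polarizationPairingOne A.X h (A.dim - 1) v (pullbackOne A ψ w))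
    (hQm : Q.Monic) (hQirr : Irreducible (Q.map (Int.castRingHom ℚ)))
    (hψQ : Polynomial.eval₂ (Int.castRingHom (CategoryTheory.End A)) (ψ : CategoryTheory.End A) Q = 0)
    (hα2 : α ≫ α = Polynomial.eval₂ (Int.castRingHom (CategoryTheory.End A)) (ψ : CategoryTheory.End A) qa)
    (hqa : ∀ z : ℂ, (Q.map (Int.castRingHom ℂ)).IsRoot z → (qa.map (Int.castRingHom ℂ)).eval z ≠ 0)
    (hβ2 : β ≫ β = Polynomial.eval₂ (Int.castRingHom (CategoryTheory.End A)) (ψ : CategoryTheory.End A) qb)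
    (hqb : ∀ z : ℂ, (Q.map (Int.castRingHom ℂ)).IsRoot z → (qb.map (Int.castRingHom ℂ)).eval z ≠ 0)
    (hanti : α ≫ β = -(β ≫ α))
    (hαsym : ∀ v w : complexBetti A.X 1, polarizationPairingOne A.X h (A.dim - 1) (pullbackOne A α v) w =
      polarizationPairingOne A.X h (A.dim - 1) v (pullbackOne A α w))
    (hβsym : ∀ v w : complexBetti A.X 1, polarizationPairingOne A.X h (A.dim - 1) (pullbackOne A β v) w =
      polarizationPairingOne A.X h (A.dim - 1) v (pullbackOne A β w))
    (hψα : ψ ≫ α = α ≫ ψ) (hψβ : ψ ≫ β = β ≫ ψ)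
    (hD : ∀ g : A ⟶ A, ∃ N : ℤ, N ≠ 0 ∧ End.of (N • g) ∈ Subring.closure {End.of ψ, End.of α, End.of β}) :
    weilClassesField A φ P (2 * m) ≤ divisorClassesSpan A.X A.dim m := by
  have hα2' : pullbackOne A α * pullbackOne A α = aeval (pullbackOne A ψ) (qa.map (Int.castRingHom ℂ)) := by
    rw [← pullbackOne_comp_eq_mul, hα2]
    exact pullbackOne_eval₂ ψ qa
  have hβ2' : pullbackOne A β * pullbackOne A β = aeval (pullbackOne A ψ) (qb.map (Int.castRingHom ℂ)) := by
    rw [← pullbackOne_comp_eq_mul, hβ2]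
    exact pullbackOne_eval₂ ψ qb
  have hanti' : pullbackOne A α * pullbackOne A β = -(pullbackOne A β * pullbackOne A α) := by
    rw [← pullbackOne_comp_eq_mul, hanti, pullbackOne_neg_eq_neg, pullbackOne_comp_eq_mul]
  have hψα' : pullbackOne A ψ * pullbackOne A α = pullbackOne A α * pullbackOne A ψ := by
    rw [← pullbackOne_comp_eq_mul, hψα, pullbackOne_comp_eq_mul]
  have hψβ' : pullbackOne A ψ * pullbackOne A β = pullbackOne A β * pullbackOne A ψ := by
    rw [← pullbackOne_comp_eq_mul, hψβ, pullbackOne_comp_eq_mul]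
  exact weilClassesField_le_divisorClassesSpan_of_mem_adjoin_quaternionOver hPm hPe hPirr hφ her hh hnd hψsym hQm hQirr hψQ
    hα2' hqa hβ2' hqb hanti' hαsym hβsym hψα' hψβ'
    (pullbackOne_mem_adjoin_triple_of_forall_exists_zsmul_mem_closure_triple hD φ)

/-- **… hence ALGEBRAIC.** [cite: MoonenZarhin1998WeilClasses, Introduction (chunk p0001 L10–L18) and §1 Criterion (2), type 2 (chunk p0003 L59–L90)]
[cite: VoisinHodgeI2002, Thm. 11.30] -/
theorem weilClassesField_le_algebraicClasses_of_indefiniteQuaternionOver_End (hPm : P.Monic) (hPe : P.natDegree = e)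
    (hPirr : Irreducible (P.map (Int.castRingHom ℚ)))
    (hφ : Polynomial.eval₂ (Int.castRingHom (CategoryTheory.End A)) (φ : CategoryTheory.End A) P = 0)
    (her : e * (2 * m) = 2 * A.dim) (hh : h ∈ hodgeClassSpan A.dim A.X 1)
    (hnd : ∀ v : complexBetti A.X 1, (∀ w, polarizationPairingOne A.X h (A.dim - 1) v w = 0) → v = 0)
    (hψsym : ∀ v w : complexBetti A.X 1, polarizationPairingOne A.X h (A.dim - 1) (pullbackOne A ψ v) w =
      polarizationPairingOne A.X h (A.dim - 1) v (pullbackOne A ψ w))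
    (hQm : Q.Monic) (hQirr : Irreducible (Q.map (Int.castRingHom ℚ)))
    (hψQ : Polynomial.eval₂ (Int.castRingHom (CategoryTheory.End A)) (ψ : CategoryTheory.End A) Q = 0)
    (hα2 : α ≫ α = Polynomial.eval₂ (Int.castRingHom (CategoryTheory.End A)) (ψ : CategoryTheory.End A) qa)
    (hqa : ∀ z : ℂ, (Q.map (Int.castRingHom ℂ)).IsRoot z → (qa.map (Int.castRingHom ℂ)).eval z ≠ 0)
    (hβ2 : β ≫ β = Polynomial.eval₂ (Int.castRingHom (CategoryTheory.End A)) (ψ : CategoryTheory.End A) qb)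
    (hqb : ∀ z : ℂ, (Q.map (Int.castRingHom ℂ)).IsRoot z → (qb.map (Int.castRingHom ℂ)).eval z ≠ 0)
    (hanti : α ≫ β = -(β ≫ α))
    (hαsym : ∀ v w : complexBetti A.X 1, polarizationPairingOne A.X h (A.dim - 1) (pullbackOne A α v) w =
      polarizationPairingOne A.X h (A.dim - 1) v (pullbackOne A α w))
    (hβsym : ∀ v w : complexBetti A.X 1, polarizationPairingOne A.X h (A.dim - 1) (pullbackOne A β v) w =
      polarizationPairingOne A.X h (A.dim - 1) v (pullbackOne A β w))
    (hψα : ψ ≫ α = α ≫ ψ) (hψβ : ψ ≫ β = β ≫ ψ)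
    (hD : ∀ g : A ⟶ A, ∃ N : ℤ, N ≠ 0 ∧ End.of (N • g) ∈ Subring.closure {End.of ψ, End.of α, End.of β}) :
    weilClassesField A φ P (2 * m) ≤ algebraicClasses A.X m :=
  (weilClassesField_le_divisorClassesSpan_of_indefiniteQuaternionOver_End hPm hPe hPirr hφ her hh hnd hψsym hQm hQirr hψQ
      hα2 hqa hβ2 hqb hanti hαsym hβsym hψα hψβ hD).trans
    (AbelianVariety.divisorClassesSpan_le_algebraicClasses A
      (fun c hc hc' ↦ lefschetzOneOne_rational_holds (AbelianVariety.isSmoothProjective_holds (A := A)) c hc hc') m)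

/-- **TYPE 2 FROM `End(A)`, POWERS: EVERY `φ ∈ End(A^{n+1})` HAS DECOMPOSABLE WEIL CLASSES** (same presentation of
`End⁰(A) = D`; `X = A^{n+1}` with the product polarization, `h^{dim A} ≠ 0`): «`F ⊆ End⁰(X) = M_{n+1}(D)`» is
automatic (`pullbackOne_mem_adjoin_diagonal_of_forall_exists_zsmul_mem_closure_triple`), and the seat's
`weilClassesField_biproduct_le_divisorClassesSpan_of_mem_adjoin_quaternionOver_diagonal` applies.
[cite: MoonenZarhin1998WeilClasses, §1 Criterion (2) and its proof, type 2 with m ≥ 2 («Δ = D», «G_div(X) ⊆ Sl_F(V_X)»; chunk p0002 L96–L97, p0003 L59–L90)]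
[cite: Milne1999LefschetzClasses, §1 p. 643, Thm. 3.2, Cor. 4.5] [cite: LangeBirkenhake1992, §1.1, §5.5] -/
theorem weilClassesField_biproduct_le_divisorClassesSpan_of_indefiniteQuaternionOver_End (hA : 0 < A.dim)
    (hh : h ∈ hodgeClassSpan A.dim A.X 1) (htop : lefschetzPow h (A.dim - 1) 2 h ≠ 0)
    (hnd : ∀ x : complexBetti A.X 1, (∀ y, polarizationPairingOne A.X h (A.dim - 1) x y = 0) → x = 0)
    (hψsym : ∀ v w : complexBetti A.X 1, polarizationPairingOne A.X h (A.dim - 1) (pullbackOne A ψ v) w =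
      polarizationPairingOne A.X h (A.dim - 1) v (pullbackOne A ψ w))
    (hQm : Q.Monic) (hQirr : Irreducible (Q.map (Int.castRingHom ℚ)))
    (hψQ : Polynomial.eval₂ (Int.castRingHom (CategoryTheory.End A)) (ψ : CategoryTheory.End A) Q = 0)
    (hα2 : α ≫ α = Polynomial.eval₂ (Int.castRingHom (CategoryTheory.End A)) (ψ : CategoryTheory.End A) qa)
    (hqa : ∀ z : ℂ, (Q.map (Int.castRingHom ℂ)).IsRoot z → (qa.map (Int.castRingHom ℂ)).eval z ≠ 0)
    (hβ2 : β ≫ β = Polynomial.eval₂ (Int.castRingHom (CategoryTheory.End A)) (ψ : CategoryTheory.End A) qb)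
    (hqb : ∀ z : ℂ, (Q.map (Int.castRingHom ℂ)).IsRoot z → (qb.map (Int.castRingHom ℂ)).eval z ≠ 0)
    (hanti : α ≫ β = -(β ≫ α))
    (hαsym : ∀ v w : complexBetti A.X 1, polarizationPairingOne A.X h (A.dim - 1) (pullbackOne A α v) w =
      polarizationPairingOne A.X h (A.dim - 1) v (pullbackOne A α w))
    (hβsym : ∀ v w : complexBetti A.X 1, polarizationPairingOne A.X h (A.dim - 1) (pullbackOne A β v) w =
      polarizationPairingOne A.X h (A.dim - 1) v (pullbackOne A β w))
    (hψα : ψ ≫ α = α ≫ ψ) (hψβ : ψ ≫ β = β ≫ ψ)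
    (hD : ∀ g : A ⟶ A, ∃ N : ℤ, N ≠ 0 ∧ End.of (N • g) ∈ Subring.closure {End.of ψ, End.of α, End.of β})
    (hPm : P.Monic) (hPe : P.natDegree = e) (hPirr : Irreducible (P.map (Int.castRingHom ℚ)))
    (hΦ : Polynomial.eval₂ (Int.castRingHom (CategoryTheory.End (⨁ (fun _ : Fin (n + 1) => A))))
      (Φ : CategoryTheory.End (⨁ (fun _ : Fin (n + 1) => A))) P = 0)
    (her : e * (2 * m) = 2 * ((n + 1) * A.dim)) :
    weilClassesField (⨁ (fun _ : Fin (n + 1) => A)) Φ P (2 * m) ≤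
      divisorClassesSpan (⨁ (fun _ : Fin (n + 1) => A)).X (⨁ (fun _ : Fin (n + 1) => A)).dim m := by
  have hα2' : pullbackOne A α * pullbackOne A α = aeval (pullbackOne A ψ) (qa.map (Int.castRingHom ℂ)) := by
    rw [← pullbackOne_comp_eq_mul, hα2]
    exact pullbackOne_eval₂ ψ qa
  have hβ2' : pullbackOne A β * pullbackOne A β = aeval (pullbackOne A ψ) (qb.map (Int.castRingHom ℂ)) := by
    rw [← pullbackOne_comp_eq_mul, hβ2]
    exact pullbackOne_eval₂ ψ qb
  have hanti' : pullbackOne A α * pullbackOne A β = -(pullbackOne A β * pullbackOne A α) := by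
    rw [← pullbackOne_comp_eq_mul, hanti, pullbackOne_neg_eq_neg, pullbackOne_comp_eq_mul]
  have hψα' : pullbackOne A ψ * pullbackOne A α = pullbackOne A α * pullbackOne A ψ := by
    rw [← pullbackOne_comp_eq_mul, hψα, pullbackOne_comp_eq_mul]
  have hψβ' : pullbackOne A ψ * pullbackOne A β = pullbackOne A β * pullbackOne A ψ := by
    rw [← pullbackOne_comp_eq_mul, hψβ, pullbackOne_comp_eq_mul]
  exact weilClassesField_biproduct_le_divisorClassesSpan_of_mem_adjoin_quaternionOver_diagonal hA hh htop hnd hψsym hQm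
    hQirr hψQ hα2' hqa hβ2' hqb hanti' hαsym hβsym hψα' hψβ' hPm hPe hPirr hΦ her
    (pullbackOne_mem_adjoin_diagonal_of_forall_exists_zsmul_mem_closure_triple (n := n) hD Φ)

/-- **… hence ALGEBRAIC** on `A^{n+1}`. [cite: MoonenZarhin1998WeilClasses, Introduction (chunk p0001 L10–L18) and §1 Criterion (2), type 2 (chunk p0003 L59–L90)]
[cite: VoisinHodgeI2002, Thm. 11.30] -/
theorem weilClassesField_biproduct_le_algebraicClasses_of_indefiniteQuaternionOver_End (hA : 0 < A.dim)
    (hh : h ∈ hodgeClassSpan A.dim A.X 1) (htop : lefschetzPow h (A.dim - 1) 2 h ≠ 0)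
    (hnd : ∀ x : complexBetti A.X 1, (∀ y, polarizationPairingOne A.X h (A.dim - 1) x y = 0) → x = 0)
    (hψsym : ∀ v w : complexBetti A.X 1, polarizationPairingOne A.X h (A.dim - 1) (pullbackOne A ψ v) w =
      polarizationPairingOne A.X h (A.dim - 1) v (pullbackOne A ψ w))
    (hQm : Q.Monic) (hQirr : Irreducible (Q.map (Int.castRingHom ℚ)))
    (hψQ : Polynomial.eval₂ (Int.castRingHom (CategoryTheory.End A)) (ψ : CategoryTheory.End A) Q = 0)
    (hα2 : α ≫ α = Polynomial.eval₂ (Int.castRingHom (CategoryTheory.End A)) (ψ : CategoryTheory.End A) qa)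
    (hqa : ∀ z : ℂ, (Q.map (Int.castRingHom ℂ)).IsRoot z → (qa.map (Int.castRingHom ℂ)).eval z ≠ 0)
    (hβ2 : β ≫ β = Polynomial.eval₂ (Int.castRingHom (CategoryTheory.End A)) (ψ : CategoryTheory.End A) qb)
    (hqb : ∀ z : ℂ, (Q.map (Int.castRingHom ℂ)).IsRoot z → (qb.map (Int.castRingHom ℂ)).eval z ≠ 0)
    (hanti : α ≫ β = -(β ≫ α))
    (hαsym : ∀ v w : complexBetti A.X 1, polarizationPairingOne A.X h (A.dim - 1) (pullbackOne A α v) w =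
      polarizationPairingOne A.X h (A.dim - 1) v (pullbackOne A α w))
    (hβsym : ∀ v w : complexBetti A.X 1, polarizationPairingOne A.X h (A.dim - 1) (pullbackOne A β v) w =
      polarizationPairingOne A.X h (A.dim - 1) v (pullbackOne A β w))
    (hψα : ψ ≫ α = α ≫ ψ) (hψβ : ψ ≫ β = β ≫ ψ)
    (hD : ∀ g : A ⟶ A, ∃ N : ℤ, N ≠ 0 ∧ End.of (N • g) ∈ Subring.closure {End.of ψ, End.of α, End.of β})
    (hPm : P.Monic) (hPe : P.natDegree = e) (hPirr : Irreducible (P.map (Int.castRingHom ℚ)))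
    (hΦ : Polynomial.eval₂ (Int.castRingHom (CategoryTheory.End (⨁ (fun _ : Fin (n + 1) => A))))
      (Φ : CategoryTheory.End (⨁ (fun _ : Fin (n + 1) => A))) P = 0)
    (her : e * (2 * m) = 2 * ((n + 1) * A.dim)) :
    weilClassesField (⨁ (fun _ : Fin (n + 1) => A)) Φ P (2 * m) ≤ algebraicClasses (⨁ (fun _ : Fin (n + 1) => A)).X m :=
  (weilClassesField_biproduct_le_divisorClassesSpan_of_indefiniteQuaternionOver_End hA hh htop hnd hψsym hQm hQirr hψQ
      hα2 hqa hβ2 hqb hanti hαsym hβsym hψα hψβ hD hPm hPe hPirr hΦ her).trans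
    (AbelianVariety.divisorClassesSpan_le_algebraicClasses (⨁ (fun _ : Fin (n + 1) => A))
      (fun c hc hc' ↦ lefschetzOneOne_rational_holds
        (AbelianVariety.isSmoothProjective_holds (A := (⨁ (fun _ : Fin (n + 1) => A)))) c hc hc') m)

end TypeTwo

end Literature.AlgebraicGeometry.HodgeTheory

end
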